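import Literature.NumberTheory.Rogawski1990.CartanObsHasseOfSteps
import Literature.NumberTheory.Rogawski1990.AdelicCartanClassConverse
import Literature.NumberTheory.Rogawski1990.AdelicCartanDisc
import Literature.NumberTheory.Rogawski1990.AdelicCartanArch
import HarnessLib

/-!
# Kottwitz's criterion (Prop. 3.3.1) assembled WITHOUT REGULARITY: `obs p = 0 ↔ p` rational, from (P4) the global-representative reading of `obs`,
# an adelic conjugator for every matching adèle, and the local-to-adelic gluing at the stable class of `γ₀` — the socket for the SINGULAR
# semisimple classes of `U(H)` (Rogawski 1990, §3.3 Prop. 3.3.1 p. 22, §3.8 Prop. 3.8.1 p. 27, §5.4 p. 72; Kottwitz 1986 §7, §9)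

Topic `NumberTheory/Rogawski1990`; namespace `Literature.NumberTheory.Rogawski1990`; **THEOREMS ONLY** (no definition, no named fact, no instance, no
notation, no `sorry`).  Cell `pub/hodgecm-mathlib`, ENGINE T1 (crux H413 = `stmt-HodgeConjecture-24833`), rows G6 ∕ O7 (CENSUS-O7 v3 §3 «singular ObsHasse»;
RULING #107 (2)): ★ P5 `cartanObsHasse_of_steps` uses the regularity of `γ₀` in exactly TWO places — the existence of an adelic conjugator of a matching adèle
(★ R6b `MatchingAdeleG₂.exists_gl_conj_eq_adele hreg`) and the gluing of place-by-place conjugacies into a `U(H)(𝐀)`-conjugacy (★ R6b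
`MatchingAdeleG₂.isRationalOver_of_isConj_arch_of_forall_isConj_toLocal … hreg`, Kottwitz 7.1); its other inputs — (P2) `hdisc` ★ `cartanObsHasse_hdisc`,
(P3) `hsig` ★ `cartanObsHasse_hsig`, (P1) `hloc` ★ `MatchingAdeleG₂.forall_isConj_toLocal_and_isConj_arch_of_adelicCartan_eq`, the realisation ★ R6a
`exists_unitary_conj_inv_mul_twistGram_eq_of_invariants`, and «rational ⇒ principal class» ★ R6d-β `exists_exists_commute_adelicCartan_eq_map_of_isRationalOver` —
are ★ for EVERY `γ₀ ∈ U(H)(L⁺)`.  This file re-assembles Prop. 3.3.1 with those two uses turned into HYPOTHESES `hconj`, `hglue` and (P1)(P2)(P3) DISCHARGED,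
so that the singular road (K1 frame, block centraliser `U(H_a) × U(H_b)`, `|𝓡| = 2`, [§3.8 Prop. 3.8.1]) only has to supply its own `obs_s` with (P4-s)
`hglob`, the conjugators (★ F3′ (b) currency) and the gluing (K6-α currency) — and so that the regular case is visibly «P5 = this + R6b ×2».

* **`MatchingAdeleG₂.obsHasse_of_hglob_of_conj_of_glue`** — for `H` hermitian non-degenerate over the CM field `L`, ANY `γ₀ ∈ U(H)(L⁺)`, any abelian group `A`
  and `obs : 𝒞′_𝐀(γ₀) → A` with (P4) `hglob` (★ P5's binder VERBATIM), `hconj : ∀ p, ∃ g, g (γ₀ ⊗ 1) g⁻¹ = p.adele` and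
  `hglue : ∀ p δ, γ₀ ∼_st δ → δ_∞ ∼ p_∞ → (∀ v, δ_v ∼ p_v) → p.IsRationalOver δ`: **`obs p = 0 ↔ ∃ γ, p.IsRationalOver γ`** for every `p`;
* `MatchingAdeleG₂.obsHasse_of_steps_of_conj_of_glue` — the same with (P1)(P2)(P3) still as hypotheses (★ P5's four binders VERBATIM + `hconj` + `hglue`), for roads
  that want to feed their own readings.

HONEST LABEL: nothing printed is consumed; at a REGULAR `γ₀` this is ★ P5 ∕ ★ R7b; at a SINGULAR `γ₀` the obstruction `obs_s`, `hglob`, `hconj`, `hglue` are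
O7's K4-image ∕ K6-α rows (CENSUS-O7 v3).  HC_CM is proved only modulo the printed citations until rung 0 closes.

## References
* [Rogawski1990] J. D. Rogawski, *Automorphic Representations of Unitary Groups in Three Variables*, Ann. of Math. Stud. 123 (1990), §3.3 Prop. 3.3.1 p. 22,
  §3.5 Prop. 3.5.2 p. 29, §3.8 Prop. 3.8.1 p. 27, §5.4 p. 72.
* [Kottwitz1986] R. E. Kottwitz, *Stable trace formula: elliptic singular terms*, Math. Ann. 275 (1986), §7 Prop. 7.1, §9.
-/

set_option autoImplicit false

noncomputable section

open NumberField IsDedekindDomain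
open scoped Matrix MatrixGroups

namespace Literature.NumberTheory.Rogawski1990

open Literature.NumberTheory.Automorphic
open Literature.AlgebraicGeometry.ShimuraVarieties (unitaryGroup mem_unitaryGroup_iff)

section Self

variable {L : Type} [Field L] [NumberField L] [IsCMField L] {H : Matrix (Fin 3) (Fin 3) L} {γ₀ : (UnitaryGroup.cmDatum L 3 H).Rational}

/-- **PROP. 3.3.1 ASSEMBLED WITHOUT REGULARITY, (P1)(P2)(P3) AS HYPOTHESES** — ★ P5 `cartanObsHasse_of_steps` with its two uses of `hreg` replaced by the
hypotheses `hconj` (every matching adèle over `γ₀` has an adelic conjugator `g ∈ GL₃(𝔸_L)`) and `hglue` (a rational `δ ∼_st γ₀` conjugate to `p` at `∞` and at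
every finite place is `U(H)(𝐀)`-conjugate to `p`); the four step-binders `hglob` `hdisc` `hsig` `hloc` are P5's VERBATIM.  (Proof = P5's, line for line.)
[cite: Rogawski1990, §3.3 Prop. 3.3.1 p. 22; §3.8 Prop. 3.8.1 p. 27; §5.4 p. 72] [cite: Kottwitz1986, §7 Prop. 7.1, §9] -/
theorem MatchingAdeleG₂.obsHasse_of_steps_of_conj_of_glue (hH : (H.map (cmConjRingHom L))ᵀ = H) (hHd : H.det ≠ 0)
    {A : Type*} [AddCommGroup A] (obs : MatchingAdeleG₂ L H H γ₀ → A)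
    (hconj : ∀ p : MatchingAdeleG₂ L H H γ₀, ∃ g : GL (Fin 3) (AdeleRing (𝓞 L) L),
      g * (((UnitaryGroup.cmDatum L 3 H).toAdelic γ₀).val : GL (Fin 3) (AdeleRing (𝓞 L) L)) * g⁻¹ = (p.adele.val : GL (Fin 3) (AdeleRing (𝓞 L) L)))
    (hglue : ∀ (p : MatchingAdeleG₂ L H H γ₀) (δ : (UnitaryGroup.cmDatum L 3 H).Rational),
      IsStablyConj (cmConjRingHom L) H (γ₀ : unitaryGroup (cmConjRingHom L) H) (δ : unitaryGroup (cmConjRingHom L) H) →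
      IsConj (cmRationalToArch L 3 H δ) p.arch →
      (∀ v : HeightOneSpectrum (𝓞 ↥(maximalRealSubfield L)),
        IsConj ((UnitaryGroup.cmDatum L 3 H).toLocal v ((UnitaryGroup.cmDatum L 3 H).toAdelic δ)) ((UnitaryGroup.cmDatum L 3 H).toLocal v p.adele)) →
      p.IsRationalOver δ)
    (hglob : ∀ (p : MatchingAdeleG₂ L H H γ₀) (g : GL (Fin 3) (AdeleRing (𝓞 L) L)),
      g * (((UnitaryGroup.cmDatum L 3 H).toAdelic γ₀).val : GL (Fin 3) (AdeleRing (𝓞 L) L)) * g⁻¹ = (p.adele.val : GL (Fin 3) (AdeleRing (𝓞 L) L)) →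
      (obs p = 0 ↔ ∃ (y : Matrix (Fin 3) (Fin 3) L) (t : GL (Fin 3) (AdeleRing (𝓞 L) L)),
        Commute y (((γ₀ : unitaryGroup (cmConjRingHom L) H).val : GL (Fin 3) L) : Matrix (Fin 3) (Fin 3) L) ∧
        hermStar (cmConjRingHom L) H y = y ∧ IsUnit y.det ∧
        t * (((UnitaryGroup.cmDatum L 3 H).toAdelic γ₀).val : GL (Fin 3) (AdeleRing (𝓞 L) L)) =
          (((UnitaryGroup.cmDatum L 3 H).toAdelic γ₀).val : GL (Fin 3) (AdeleRing (𝓞 L) L)) * t ∧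
        (H.map (algebraMap L (AdeleRing (𝓞 L) L)))⁻¹ * twistGram (adeleConj L) (H.map (algebraMap L (AdeleRing (𝓞 L) L))) (g : Matrix (Fin 3) (Fin 3) (AdeleRing (𝓞 L) L)) =
          hermStar (adeleConj L) (H.map (algebraMap L (AdeleRing (𝓞 L) L))) (t : Matrix (Fin 3) (Fin 3) (AdeleRing (𝓞 L) L)) *
            y.map (algebraMap L (AdeleRing (𝓞 L) L)) * (t : Matrix (Fin 3) (Fin 3) (AdeleRing (𝓞 L) L))))
    (hdisc : ∀ (p : MatchingAdeleG₂ L H H γ₀) (g : GL (Fin 3) (AdeleRing (𝓞 L) L)) (y : Matrix (Fin 3) (Fin 3) L) (t : GL (Fin 3) (AdeleRing (𝓞 L) L)),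
      g * (((UnitaryGroup.cmDatum L 3 H).toAdelic γ₀).val : GL (Fin 3) (AdeleRing (𝓞 L) L)) * g⁻¹ = (p.adele.val : GL (Fin 3) (AdeleRing (𝓞 L) L)) →
      Commute y (((γ₀ : unitaryGroup (cmConjRingHom L) H).val : GL (Fin 3) L) : Matrix (Fin 3) (Fin 3) L) → hermStar (cmConjRingHom L) H y = y → IsUnit y.det →
      (H.map (algebraMap L (AdeleRing (𝓞 L) L)))⁻¹ * twistGram (adeleConj L) (H.map (algebraMap L (AdeleRing (𝓞 L) L))) (g : Matrix (Fin 3) (Fin 3) (AdeleRing (𝓞 L) L)) =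
        hermStar (adeleConj L) (H.map (algebraMap L (AdeleRing (𝓞 L) L))) (t : Matrix (Fin 3) (Fin 3) (AdeleRing (𝓞 L) L)) *
          y.map (algebraMap L (AdeleRing (𝓞 L) L)) * (t : Matrix (Fin 3) (Fin 3) (AdeleRing (𝓞 L) L)) →
      ∃ z : L, z ≠ 0 ∧ y.det = z * cmConjRingHom L z)
    (hsig : ∀ (p : MatchingAdeleG₂ L H H γ₀) (g : GL (Fin 3) (AdeleRing (𝓞 L) L)) (y : Matrix (Fin 3) (Fin 3) L) (t : GL (Fin 3) (AdeleRing (𝓞 L) L)),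
      g * (((UnitaryGroup.cmDatum L 3 H).toAdelic γ₀).val : GL (Fin 3) (AdeleRing (𝓞 L) L)) * g⁻¹ = (p.adele.val : GL (Fin 3) (AdeleRing (𝓞 L) L)) →
      Commute y (((γ₀ : unitaryGroup (cmConjRingHom L) H).val : GL (Fin 3) L) : Matrix (Fin 3) (Fin 3) L) → hermStar (cmConjRingHom L) H y = y → IsUnit y.det →
      (H.map (algebraMap L (AdeleRing (𝓞 L) L)))⁻¹ * twistGram (adeleConj L) (H.map (algebraMap L (AdeleRing (𝓞 L) L))) (g : Matrix (Fin 3) (Fin 3) (AdeleRing (𝓞 L) L)) =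
        hermStar (adeleConj L) (H.map (algebraMap L (AdeleRing (𝓞 L) L))) (t : Matrix (Fin 3) (Fin 3) (AdeleRing (𝓞 L) L)) *
          y.map (algebraMap L (AdeleRing (𝓞 L) L)) * (t : Matrix (Fin 3) (Fin 3) (AdeleRing (𝓞 L) L)) →
      ∀ (ρ : L →+* ℂ) (h₁ : (H.map ρ).IsHermitian) (h₂ : ((H * y).map ρ).IsHermitian),
        (Finset.univ.filter fun i => 0 < h₁.eigenvalues i).card = (Finset.univ.filter fun i => 0 < h₂.eigenvalues i).card)
    (hloc : ∀ (p q : MatchingAdeleG₂ L H H γ₀) (g g' t : GL (Fin 3) (AdeleRing (𝓞 L) L)),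
      g * (((UnitaryGroup.cmDatum L 3 H).toAdelic γ₀).val : GL (Fin 3) (AdeleRing (𝓞 L) L)) * g⁻¹ = (p.adele.val : GL (Fin 3) (AdeleRing (𝓞 L) L)) →
      g' * (((UnitaryGroup.cmDatum L 3 H).toAdelic γ₀).val : GL (Fin 3) (AdeleRing (𝓞 L) L)) * g'⁻¹ = (q.adele.val : GL (Fin 3) (AdeleRing (𝓞 L) L)) →
      t * (((UnitaryGroup.cmDatum L 3 H).toAdelic γ₀).val : GL (Fin 3) (AdeleRing (𝓞 L) L)) =
        (((UnitaryGroup.cmDatum L 3 H).toAdelic γ₀).val : GL (Fin 3) (AdeleRing (𝓞 L) L)) * t →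
      (H.map (algebraMap L (AdeleRing (𝓞 L) L)))⁻¹ * twistGram (adeleConj L) (H.map (algebraMap L (AdeleRing (𝓞 L) L))) (g : Matrix (Fin 3) (Fin 3) (AdeleRing (𝓞 L) L)) =
        hermStar (adeleConj L) (H.map (algebraMap L (AdeleRing (𝓞 L) L))) (t : Matrix (Fin 3) (Fin 3) (AdeleRing (𝓞 L) L)) *
          ((H.map (algebraMap L (AdeleRing (𝓞 L) L)))⁻¹ * twistGram (adeleConj L) (H.map (algebraMap L (AdeleRing (𝓞 L) L))) (g' : Matrix (Fin 3) (Fin 3) (AdeleRing (𝓞 L) L))) *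
          (t : Matrix (Fin 3) (Fin 3) (AdeleRing (𝓞 L) L)) →
      (∀ v : HeightOneSpectrum (𝓞 ↥(maximalRealSubfield L)),
          IsConj ((UnitaryGroup.cmDatum L 3 H).toLocal v q.adele) ((UnitaryGroup.cmDatum L 3 H).toLocal v p.adele)) ∧
        IsConj q.arch p.arch)
    (p : MatchingAdeleG₂ L H H γ₀) : obs p = 0 ↔ ∃ γ : (UnitaryGroup.cmDatum L 3 H).Rational, p.IsRationalOver γ := by
  -- adapted from ★ `cartanObsHasse_of_steps` (P5), `hreg` ↦ `hconj` ∕ `hglue`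
  obtain ⟨g, hg⟩ := hconj p
  constructor
  · -- (→): global representative ⇒ Landherr realisation ⇒ local conjugacy ⇒ gluing
    intro h0
    obtain ⟨y, t, hyγ, hys, hyu, ht, hx⟩ := (hglob p g hg).mp h0
    obtain ⟨z, hz, hdet⟩ := hdisc p g y t hg hyγ hys hyu hx
    have hsg := hsig p g y t hg hyγ hys hyu hx
    obtain ⟨g₀, δ, hg₀, hst, hcl⟩ := exists_unitary_conj_inv_mul_twistGram_eq_of_invariants L hH hHd (γ₀ : unitaryGroup (cmConjRingHom L) H) hyγ hys
      hyu.ne_zero hsg ⟨z, hz, hdet⟩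
    -- the self adèle `q = δ ⊗ 1`, conjugator `g₀ ⊗ 1`, class `y ⊗ 1`
    set q : MatchingAdeleG₂ L H H γ₀ := MatchingAdeleG₂.ofIsStablyConjSelf hst with hqdef
    have hq : q.adele = (UnitaryGroup.cmDatum L 3 H).toAdelic δ := MatchingAdeleG₂.adele_ofIsStablyConjSelf hst
    have hg' : toAdeleGL L g₀ * (((UnitaryGroup.cmDatum L 3 H).toAdelic γ₀).val : GL (Fin 3) (AdeleRing (𝓞 L) L)) * (toAdeleGL L g₀)⁻¹ =
        (q.adele.val : GL (Fin 3) (AdeleRing (𝓞 L) L)) := by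
      rw [hq, UnitaryGroup.coe_cmDatum_toAdelic, UnitaryGroup.coe_cmDatum_toAdelic, ← map_inv, ← map_mul, ← map_mul, hg₀]
    have hx' : (H.map (algebraMap L (AdeleRing (𝓞 L) L)))⁻¹ * twistGram (adeleConj L) (H.map (algebraMap L (AdeleRing (𝓞 L) L)))
          ((toAdeleGL L g₀ : GL (Fin 3) (AdeleRing (𝓞 L) L)) : Matrix (Fin 3) (Fin 3) (AdeleRing (𝓞 L) L)) = y.map (algebraMap L (AdeleRing (𝓞 L) L)) := by
      rw [val_toAdeleGL, ← twistGram_map_adele, ← Literature.LinearAlgebra.Matrix.map_nonsing_inv_of_isUnit _ (Ne.isUnit hHd), ← Matrix.map_mul, hcl]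
    have hrel : (H.map (algebraMap L (AdeleRing (𝓞 L) L)))⁻¹ * twistGram (adeleConj L) (H.map (algebraMap L (AdeleRing (𝓞 L) L))) (g : Matrix (Fin 3) (Fin 3) (AdeleRing (𝓞 L) L)) =
        hermStar (adeleConj L) (H.map (algebraMap L (AdeleRing (𝓞 L) L))) (t : Matrix (Fin 3) (Fin 3) (AdeleRing (𝓞 L) L)) *
          ((H.map (algebraMap L (AdeleRing (𝓞 L) L)))⁻¹ * twistGram (adeleConj L) (H.map (algebraMap L (AdeleRing (𝓞 L) L)))
            ((toAdeleGL L g₀ : GL (Fin 3) (AdeleRing (𝓞 L) L)) : Matrix (Fin 3) (Fin 3) (AdeleRing (𝓞 L) L))) *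
          (t : Matrix (Fin 3) (Fin 3) (AdeleRing (𝓞 L) L)) := by rw [hx', hx]
    obtain ⟨hv, ha⟩ := hloc p q g (toAdeleGL L g₀) t hg hg' ht hrel
    -- gluing (hypothesis `hglue` at the stably conjugate rational `δ`)
    refine ⟨δ, hglue p δ hst ?_ fun v => ?_⟩
    · have ha' : q.arch = cmRationalToArch L 3 H δ := by
        show UnitaryGroup.archPart (↥(maximalRealSubfield L)) L (IsCMField.complexConj L) 3 H q.adele = _
        rw [hq, archPart_cmDatum_toAdelic]
      rw [← ha']
      exact ha
    · have := hv v
      rwa [hq] at this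
  · -- (←): rational ⇒ principal (★ R6d-β) ⇒ global representative ⇒ `obs = 0` by (P4)
    rintro ⟨γ, hp⟩
    obtain ⟨g₀, hg₀, t, ht, hx⟩ := exists_exists_commute_adelicCartan_eq_map_of_isRationalOver (Ne.isUnit hHd) hp hg
    obtain ⟨hyγ, hys, hyu⟩ := globalCartan_props hH hHd hg₀
    exact (hglob p g hg).mpr ⟨_, t, hyγ, hys, hyu, ht, hx⟩

/-- **PROP. 3.3.1 ASSEMBLED WITHOUT REGULARITY — (P1)(P2)(P3) DISCHARGED**: for `H` hermitian non-degenerate over the CM field `L`, ANY `γ₀ ∈ U(H)(L⁺)`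
(regular or singular), any obstruction `obs : 𝒞′_𝐀(γ₀) → A` with the global-representative reading (P4) `hglob`, adelic conjugators `hconj` and the gluing
`hglue` at `𝒪_st(γ₀)`: `obs p = 0 ↔ ∃ γ, p.IsRationalOver γ`.  Here (P2) := ★ `cartanObsHasse_hdisc` (Hasse's norm theorem), (P3) := ★ `cartanObsHasse_hsig`
(signatures), (P1) := ★ `MatchingAdeleG₂.forall_isConj_toLocal_and_isConj_arch_of_adelicCartan_eq` (norm-equivalent classes are conjugate place by place) —
all three regularity-free.  At a regular `γ₀`, `hconj` ∕ `hglue` := ★ R6b and `obs := cartanObsFun` give ★ R7b; at a singular `γ₀` they are O7's (K1 frame ∕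
K6-α) and `obs := obs_s` [§3.8 Prop. 3.8.1, `|𝓡| = 2`]. [cite: Rogawski1990, §3.3 Prop. 3.3.1 p. 22; §3.8 Prop. 3.8.1 p. 27; §5.4 p. 72] [cite: Kottwitz1986, §7 Prop. 7.1, §9] -/
theorem MatchingAdeleG₂.obsHasse_of_hglob_of_conj_of_glue (hH : (H.map (cmConjRingHom L))ᵀ = H) (hHd : H.det ≠ 0)
    {A : Type*} [AddCommGroup A] (obs : MatchingAdeleG₂ L H H γ₀ → A)
    (hconj : ∀ p : MatchingAdeleG₂ L H H γ₀, ∃ g : GL (Fin 3) (AdeleRing (𝓞 L) L),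
      g * (((UnitaryGroup.cmDatum L 3 H).toAdelic γ₀).val : GL (Fin 3) (AdeleRing (𝓞 L) L)) * g⁻¹ = (p.adele.val : GL (Fin 3) (AdeleRing (𝓞 L) L)))
    (hglue : ∀ (p : MatchingAdeleG₂ L H H γ₀) (δ : (UnitaryGroup.cmDatum L 3 H).Rational),
      IsStablyConj (cmConjRingHom L) H (γ₀ : unitaryGroup (cmConjRingHom L) H) (δ : unitaryGroup (cmConjRingHom L) H) →
      IsConj (cmRationalToArch L 3 H δ) p.arch →
      (∀ v : HeightOneSpectrum (𝓞 ↥(maximalRealSubfield L)),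
        IsConj ((UnitaryGroup.cmDatum L 3 H).toLocal v ((UnitaryGroup.cmDatum L 3 H).toAdelic δ)) ((UnitaryGroup.cmDatum L 3 H).toLocal v p.adele)) →
      p.IsRationalOver δ)
    (hglob : ∀ (p : MatchingAdeleG₂ L H H γ₀) (g : GL (Fin 3) (AdeleRing (𝓞 L) L)),
      g * (((UnitaryGroup.cmDatum L 3 H).toAdelic γ₀).val : GL (Fin 3) (AdeleRing (𝓞 L) L)) * g⁻¹ = (p.adele.val : GL (Fin 3) (AdeleRing (𝓞 L) L)) →
      (obs p = 0 ↔ ∃ (y : Matrix (Fin 3) (Fin 3) L) (t : GL (Fin 3) (AdeleRing (𝓞 L) L)),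
        Commute y (((γ₀ : unitaryGroup (cmConjRingHom L) H).val : GL (Fin 3) L) : Matrix (Fin 3) (Fin 3) L) ∧
        hermStar (cmConjRingHom L) H y = y ∧ IsUnit y.det ∧
        t * (((UnitaryGroup.cmDatum L 3 H).toAdelic γ₀).val : GL (Fin 3) (AdeleRing (𝓞 L) L)) =
          (((UnitaryGroup.cmDatum L 3 H).toAdelic γ₀).val : GL (Fin 3) (AdeleRing (𝓞 L) L)) * t ∧
        (H.map (algebraMap L (AdeleRing (𝓞 L) L)))⁻¹ * twistGram (adeleConj L) (H.map (algebraMap L (AdeleRing (𝓞 L) L))) (g : Matrix (Fin 3) (Fin 3) (AdeleRing (𝓞 L) L)) =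
          hermStar (adeleConj L) (H.map (algebraMap L (AdeleRing (𝓞 L) L))) (t : Matrix (Fin 3) (Fin 3) (AdeleRing (𝓞 L) L)) *
            y.map (algebraMap L (AdeleRing (𝓞 L) L)) * (t : Matrix (Fin 3) (Fin 3) (AdeleRing (𝓞 L) L))))
    (p : MatchingAdeleG₂ L H H γ₀) : obs p = 0 ↔ ∃ γ : (UnitaryGroup.cmDatum L 3 H).Rational, p.IsRationalOver γ :=
  MatchingAdeleG₂.obsHasse_of_steps_of_conj_of_glue hH hHd obs hconj hglue hglob (cartanObsHasse_hdisc hHd) (cartanObsHasse_hsig hHd)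
    (fun q q' g g' t hg hg' ht hx => MatchingAdeleG₂.forall_isConj_toLocal_and_isConj_arch_of_adelicCartan_eq (Ne.isUnit hHd) q q' g g' t hg hg' ht hx) p

/-- **Sanity ∕ dedup pointer: the REGULAR case is ★ P5** — at a regular `γ₀` the two hypotheses are ★ R6b: `hconj := exists_gl_conj_eq_adele hreg` and `hglue`
from `isRationalOver_of_isConj_arch_of_forall_isConj_toLocal` (the stably conjugate `δ` is regular with `γ₀`).  Stated so that O7's singular road and G6's
regular road share ONE assembly. [cite: Rogawski1990, §3.3 Prop. 3.3.1 p. 22] [cite: Kottwitz1986, §7 Prop. 7.1] -/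
theorem MatchingAdeleG₂.hglue_of_isRegularElt (hH : (H.map (cmConjRingHom L))ᵀ = H) (hHd : H.det ≠ 0)
    (hreg : IsRegularElt ((γ₀ : unitaryGroup (cmConjRingHom L) H).val : GL (Fin 3) L)) (p : MatchingAdeleG₂ L H H γ₀)
    (δ : (UnitaryGroup.cmDatum L 3 H).Rational)
    (hst : IsStablyConj (cmConjRingHom L) H (γ₀ : unitaryGroup (cmConjRingHom L) H) (δ : unitaryGroup (cmConjRingHom L) H))
    (ha : IsConj (cmRationalToArch L 3 H δ) p.arch)
    (hv : ∀ v : HeightOneSpectrum (𝓞 ↥(maximalRealSubfield L)),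
      IsConj ((UnitaryGroup.cmDatum L 3 H).toLocal v ((UnitaryGroup.cmDatum L 3 H).toAdelic δ)) ((UnitaryGroup.cmDatum L 3 H).toLocal v p.adele)) :
    p.IsRationalOver δ := by
  obtain ⟨g₀, hg₀⟩ := isStablyConj_iff.mp hst
  exact p.isRationalOver_of_isConj_arch_of_forall_isConj_toLocal hH hHd (isRegularElt_of_conj_eq hreg hg₀) ha hv

end Self

/-! ## §2 (ED. 2) THE PLACEWISE SOCKET — Prop. 3.3.1 assembled from LOCAL Cartan-class identities (no adelic `t`)

RULING #107 (2) ∕ TRUNK WORDS #5 ∕ O7 OWNER WORD #7 (i): at a SINGULAR semisimple `γ₀` the centraliser `Z(γ₀ ⊗ 1)(𝔸) ≅ GL₂(𝔸_L) × GL₁(𝔸_L)` is not a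
torus, and an ADELIC `t` with `x_g = t⋆ (y ⊗ 1) t` would require the integral classification of binary hermitian lattices; so the singular road
supplies, for `obs p = 0`, a GLOBAL `⋆`-symmetric unit `y ∈ Z(γ₀)` WITH ITS INVARIANTS (discriminant class a norm, signatures of `H·y` = those of `H`)
and LOCAL identities `(x_g)_v = t_v⋆ (y ⊗ 1)_v t_v` at every finite `v` (in `GL₃(∏_{w∣v} L_w)`) and at `∞` (in `GL₃(L ⊗ ℝ)`).  The two readings
«local Cartan-class identity ⇒ conjugate in `U(H)(L⁺_v)`» and «… ⇒ conjugate in `U(H)(L ⊗ ℝ)`» are the generic hypotheses `hlocFin` ∕ `hlocArch`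
(★ R6a `exists_unitary_conj_iff_exists_commute_inv_mul_twistGram_eq` at `R := ∏_{w∣v} L_w` ∕ `L ⊗ ℝ`, to be discharged once for all `γ₀`); all
a.e.-integrality sits in `hglue`.  Letters: `πᵥ := UnitaryGroup.adeleToLocal L v`, `σᵥ := UnitaryGroup.conjLocal L c v`, `π_∞ := ringEquiv_mixedSpace ∘ adeleFst`,
`σ_∞ := UnitaryGroup.conjMixed L⁺ L c`, local classes = the ADELIC matrices mapped entrywise by `πᵥ` ∕ `π_∞`. -/

section Placewise

variable {L : Type} [Field L] [NumberField L] [IsCMField L] {H : Matrix (Fin 3) (Fin 3) L} {γ₀ : (UnitaryGroup.cmDatum L 3 H).Rational}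

/-- **PROP. 3.3.1 FROM THE PLACEWISE SOCKET (any `γ₀`).**  Hypotheses: `hconj` (adelic conjugators), `hglue` (gluing at `𝒪_st(γ₀)`), `hvan` = the (⇐) half
of P5's `hglob` VERBATIM («an ADELIC representative `x_g = t⋆ (y ⊗ 1) t` with `y` global forces `obs p = 0`» — available on every road, since in that
direction ★ R6d-β hands an adelic `t`), `hreal` = the (⇒) half CUT PLACEWISE («`obs p = 0` ⇒ a global `⋆`-symmetric unit `y ∈ Z(γ₀)` with
`det y ∈ N_{L∕L⁺}(Lˣ)`, signatures of `H·y` equal to those of `H`, and local identities `(x_g)_v = t_v⋆ (y⊗1)_v t_v` for all finite `v` and at `∞`»),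
and the generic per-place readings `hlocFin`, `hlocArch`.  Conclusion: `obs p = 0 ↔ ∃ γ, p.IsRationalOver γ`.  Proof = P5's with the adelic `t`
replaced by its shadows: realisation ★ R6a, the self adèle `δ ⊗ 1`, `(y ⊗ 1)_v = (x_{g₀ ⊗ 1})_v` by ★ `twistGram_map_adele` mapped along `πᵥ` ∕ `π_∞`,
then `hlocFin` ∕ `hlocArch` and `hglue`; (⇐) ★ R6d-β + ★ `globalCartan_props` + `hvan`.
[cite: Rogawski1990, §3.3 Prop. 3.3.1 p. 22; §3.8 Prop. 3.8.1 p. 27; §5.4 p. 72] [cite: Kottwitz1986, §7 Prop. 7.1, §9] -/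
theorem MatchingAdeleG₂.obsHasse_of_placewise (hH : (H.map (cmConjRingHom L))ᵀ = H) (hHd : H.det ≠ 0)
    {A : Type*} [AddCommGroup A] (obs : MatchingAdeleG₂ L H H γ₀ → A)
    (hconj : ∀ p : MatchingAdeleG₂ L H H γ₀, ∃ g : GL (Fin 3) (AdeleRing (𝓞 L) L),
      g * (((UnitaryGroup.cmDatum L 3 H).toAdelic γ₀).val : GL (Fin 3) (AdeleRing (𝓞 L) L)) * g⁻¹ = (p.adele.val : GL (Fin 3) (AdeleRing (𝓞 L) L)))
    (hglue : ∀ (p : MatchingAdeleG₂ L H H γ₀) (δ : (UnitaryGroup.cmDatum L 3 H).Rational),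
      IsStablyConj (cmConjRingHom L) H (γ₀ : unitaryGroup (cmConjRingHom L) H) (δ : unitaryGroup (cmConjRingHom L) H) →
      IsConj (cmRationalToArch L 3 H δ) p.arch →
      (∀ v : HeightOneSpectrum (𝓞 ↥(maximalRealSubfield L)),
        IsConj ((UnitaryGroup.cmDatum L 3 H).toLocal v ((UnitaryGroup.cmDatum L 3 H).toAdelic δ)) ((UnitaryGroup.cmDatum L 3 H).toLocal v p.adele)) →
      p.IsRationalOver δ)
    (hvan : ∀ (p : MatchingAdeleG₂ L H H γ₀) (g : GL (Fin 3) (AdeleRing (𝓞 L) L)) (y : Matrix (Fin 3) (Fin 3) L) (t : GL (Fin 3) (AdeleRing (𝓞 L) L)),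
      g * (((UnitaryGroup.cmDatum L 3 H).toAdelic γ₀).val : GL (Fin 3) (AdeleRing (𝓞 L) L)) * g⁻¹ = (p.adele.val : GL (Fin 3) (AdeleRing (𝓞 L) L)) →
      Commute y (((γ₀ : unitaryGroup (cmConjRingHom L) H).val : GL (Fin 3) L) : Matrix (Fin 3) (Fin 3) L) → hermStar (cmConjRingHom L) H y = y → IsUnit y.det →
      t * (((UnitaryGroup.cmDatum L 3 H).toAdelic γ₀).val : GL (Fin 3) (AdeleRing (𝓞 L) L)) =
        (((UnitaryGroup.cmDatum L 3 H).toAdelic γ₀).val : GL (Fin 3) (AdeleRing (𝓞 L) L)) * t →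
      (H.map (algebraMap L (AdeleRing (𝓞 L) L)))⁻¹ * twistGram (adeleConj L) (H.map (algebraMap L (AdeleRing (𝓞 L) L))) (g : Matrix (Fin 3) (Fin 3) (AdeleRing (𝓞 L) L)) =
        hermStar (adeleConj L) (H.map (algebraMap L (AdeleRing (𝓞 L) L))) (t : Matrix (Fin 3) (Fin 3) (AdeleRing (𝓞 L) L)) *
          y.map (algebraMap L (AdeleRing (𝓞 L) L)) * (t : Matrix (Fin 3) (Fin 3) (AdeleRing (𝓞 L) L)) →
      obs p = 0)
    (hreal : ∀ (p : MatchingAdeleG₂ L H H γ₀) (g : GL (Fin 3) (AdeleRing (𝓞 L) L)),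
      g * (((UnitaryGroup.cmDatum L 3 H).toAdelic γ₀).val : GL (Fin 3) (AdeleRing (𝓞 L) L)) * g⁻¹ = (p.adele.val : GL (Fin 3) (AdeleRing (𝓞 L) L)) →
      obs p = 0 →
      ∃ y : Matrix (Fin 3) (Fin 3) L,
        Commute y (((γ₀ : unitaryGroup (cmConjRingHom L) H).val : GL (Fin 3) L) : Matrix (Fin 3) (Fin 3) L) ∧
        hermStar (cmConjRingHom L) H y = y ∧ IsUnit y.det ∧
        (∃ z : L, z ≠ 0 ∧ y.det = z * cmConjRingHom L z) ∧
        (∀ (ρ : L →+* ℂ) (h₁ : (H.map ρ).IsHermitian) (h₂ : ((H * y).map ρ).IsHermitian),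
          (Finset.univ.filter fun i => 0 < h₁.eigenvalues i).card = (Finset.univ.filter fun i => 0 < h₂.eigenvalues i).card) ∧
        (∀ v : HeightOneSpectrum (𝓞 ↥(maximalRealSubfield L)), ∃ t : GL (Fin 3) (UnitaryGroup.LocalRing L v),
          t * Matrix.GeneralLinearGroup.map (UnitaryGroup.adeleToLocal L v) (((UnitaryGroup.cmDatum L 3 H).toAdelic γ₀).val : GL (Fin 3) (AdeleRing (𝓞 L) L)) =
            Matrix.GeneralLinearGroup.map (UnitaryGroup.adeleToLocal L v) (((UnitaryGroup.cmDatum L 3 H).toAdelic γ₀).val : GL (Fin 3) (AdeleRing (𝓞 L) L)) * t ∧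
          ((H.map (algebraMap L (AdeleRing (𝓞 L) L)))⁻¹ * twistGram (adeleConj L) (H.map (algebraMap L (AdeleRing (𝓞 L) L))) (g : Matrix (Fin 3) (Fin 3) (AdeleRing (𝓞 L) L))).map
              (UnitaryGroup.adeleToLocal L v) =
            hermStar (UnitaryGroup.conjLocal L (IsCMField.complexConj L) v) ((H.map (algebraMap L (AdeleRing (𝓞 L) L))).map (UnitaryGroup.adeleToLocal L v))
                (t.val : Matrix (Fin 3) (Fin 3) (UnitaryGroup.LocalRing L v)) *
              (y.map (algebraMap L (AdeleRing (𝓞 L) L))).map (UnitaryGroup.adeleToLocal L v) * (t.val : Matrix (Fin 3) (Fin 3) (UnitaryGroup.LocalRing L v))) ∧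
        (∃ t : GL (Fin 3) (NumberField.mixedEmbedding.mixedSpace L),
          t * Matrix.GeneralLinearGroup.map ((InfiniteAdeleRing.ringEquiv_mixedSpace L).toRingHom.comp (UnitaryGroup.adeleFst L))
                (((UnitaryGroup.cmDatum L 3 H).toAdelic γ₀).val : GL (Fin 3) (AdeleRing (𝓞 L) L)) =
            Matrix.GeneralLinearGroup.map ((InfiniteAdeleRing.ringEquiv_mixedSpace L).toRingHom.comp (UnitaryGroup.adeleFst L))
                (((UnitaryGroup.cmDatum L 3 H).toAdelic γ₀).val : GL (Fin 3) (AdeleRing (𝓞 L) L)) * t ∧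
          ((H.map (algebraMap L (AdeleRing (𝓞 L) L)))⁻¹ * twistGram (adeleConj L) (H.map (algebraMap L (AdeleRing (𝓞 L) L))) (g : Matrix (Fin 3) (Fin 3) (AdeleRing (𝓞 L) L))).map
              ((InfiniteAdeleRing.ringEquiv_mixedSpace L).toRingHom.comp (UnitaryGroup.adeleFst L)) =
            hermStar (UnitaryGroup.conjMixed (↥(maximalRealSubfield L)) L (IsCMField.complexConj L))
                ((H.map (algebraMap L (AdeleRing (𝓞 L) L))).map ((InfiniteAdeleRing.ringEquiv_mixedSpace L).toRingHom.comp (UnitaryGroup.adeleFst L)))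
                (t.val : Matrix (Fin 3) (Fin 3) (NumberField.mixedEmbedding.mixedSpace L)) *
              (y.map (algebraMap L (AdeleRing (𝓞 L) L))).map ((InfiniteAdeleRing.ringEquiv_mixedSpace L).toRingHom.comp (UnitaryGroup.adeleFst L)) *
              (t.val : Matrix (Fin 3) (Fin 3) (NumberField.mixedEmbedding.mixedSpace L))))
    (hlocFin : ∀ (p q : MatchingAdeleG₂ L H H γ₀) (g g' : GL (Fin 3) (AdeleRing (𝓞 L) L)) (v : HeightOneSpectrum (𝓞 ↥(maximalRealSubfield L)))
        (t : GL (Fin 3) (UnitaryGroup.LocalRing L v)),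
      g * (((UnitaryGroup.cmDatum L 3 H).toAdelic γ₀).val : GL (Fin 3) (AdeleRing (𝓞 L) L)) * g⁻¹ = (p.adele.val : GL (Fin 3) (AdeleRing (𝓞 L) L)) →
      g' * (((UnitaryGroup.cmDatum L 3 H).toAdelic γ₀).val : GL (Fin 3) (AdeleRing (𝓞 L) L)) * g'⁻¹ = (q.adele.val : GL (Fin 3) (AdeleRing (𝓞 L) L)) →
      t * Matrix.GeneralLinearGroup.map (UnitaryGroup.adeleToLocal L v) (((UnitaryGroup.cmDatum L 3 H).toAdelic γ₀).val : GL (Fin 3) (AdeleRing (𝓞 L) L)) =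
        Matrix.GeneralLinearGroup.map (UnitaryGroup.adeleToLocal L v) (((UnitaryGroup.cmDatum L 3 H).toAdelic γ₀).val : GL (Fin 3) (AdeleRing (𝓞 L) L)) * t →
      ((H.map (algebraMap L (AdeleRing (𝓞 L) L)))⁻¹ * twistGram (adeleConj L) (H.map (algebraMap L (AdeleRing (𝓞 L) L))) (g : Matrix (Fin 3) (Fin 3) (AdeleRing (𝓞 L) L))).map
          (UnitaryGroup.adeleToLocal L v) =
        hermStar (UnitaryGroup.conjLocal L (IsCMField.complexConj L) v) ((H.map (algebraMap L (AdeleRing (𝓞 L) L))).map (UnitaryGroup.adeleToLocal L v))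
            (t.val : Matrix (Fin 3) (Fin 3) (UnitaryGroup.LocalRing L v)) *
          ((H.map (algebraMap L (AdeleRing (𝓞 L) L)))⁻¹ * twistGram (adeleConj L) (H.map (algebraMap L (AdeleRing (𝓞 L) L))) (g' : Matrix (Fin 3) (Fin 3) (AdeleRing (𝓞 L) L))).map
            (UnitaryGroup.adeleToLocal L v) * (t.val : Matrix (Fin 3) (Fin 3) (UnitaryGroup.LocalRing L v)) →
      IsConj ((UnitaryGroup.cmDatum L 3 H).toLocal v q.adele) ((UnitaryGroup.cmDatum L 3 H).toLocal v p.adele))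
    (hlocArch : ∀ (p q : MatchingAdeleG₂ L H H γ₀) (g g' : GL (Fin 3) (AdeleRing (𝓞 L) L)) (t : GL (Fin 3) (NumberField.mixedEmbedding.mixedSpace L)),
      g * (((UnitaryGroup.cmDatum L 3 H).toAdelic γ₀).val : GL (Fin 3) (AdeleRing (𝓞 L) L)) * g⁻¹ = (p.adele.val : GL (Fin 3) (AdeleRing (𝓞 L) L)) →
      g' * (((UnitaryGroup.cmDatum L 3 H).toAdelic γ₀).val : GL (Fin 3) (AdeleRing (𝓞 L) L)) * g'⁻¹ = (q.adele.val : GL (Fin 3) (AdeleRing (𝓞 L) L)) →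
      t * Matrix.GeneralLinearGroup.map ((InfiniteAdeleRing.ringEquiv_mixedSpace L).toRingHom.comp (UnitaryGroup.adeleFst L))
            (((UnitaryGroup.cmDatum L 3 H).toAdelic γ₀).val : GL (Fin 3) (AdeleRing (𝓞 L) L)) =
        Matrix.GeneralLinearGroup.map ((InfiniteAdeleRing.ringEquiv_mixedSpace L).toRingHom.comp (UnitaryGroup.adeleFst L))
            (((UnitaryGroup.cmDatum L 3 H).toAdelic γ₀).val : GL (Fin 3) (AdeleRing (𝓞 L) L)) * t →
      ((H.map (algebraMap L (AdeleRing (𝓞 L) L)))⁻¹ * twistGram (adeleConj L) (H.map (algebraMap L (AdeleRing (𝓞 L) L))) (g : Matrix (Fin 3) (Fin 3) (AdeleRing (𝓞 L) L))).map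
          ((InfiniteAdeleRing.ringEquiv_mixedSpace L).toRingHom.comp (UnitaryGroup.adeleFst L)) =
        hermStar (UnitaryGroup.conjMixed (↥(maximalRealSubfield L)) L (IsCMField.complexConj L))
            ((H.map (algebraMap L (AdeleRing (𝓞 L) L))).map ((InfiniteAdeleRing.ringEquiv_mixedSpace L).toRingHom.comp (UnitaryGroup.adeleFst L)))
            (t.val : Matrix (Fin 3) (Fin 3) (NumberField.mixedEmbedding.mixedSpace L)) *
          ((H.map (algebraMap L (AdeleRing (𝓞 L) L)))⁻¹ * twistGram (adeleConj L) (H.map (algebraMap L (AdeleRing (𝓞 L) L))) (g' : Matrix (Fin 3) (Fin 3) (AdeleRing (𝓞 L) L))).map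
            ((InfiniteAdeleRing.ringEquiv_mixedSpace L).toRingHom.comp (UnitaryGroup.adeleFst L)) * (t.val : Matrix (Fin 3) (Fin 3) (NumberField.mixedEmbedding.mixedSpace L)) →
      IsConj q.arch p.arch)
    (p : MatchingAdeleG₂ L H H γ₀) : obs p = 0 ↔ ∃ γ : (UnitaryGroup.cmDatum L 3 H).Rational, p.IsRationalOver γ := by
  obtain ⟨g, hg⟩ := hconj p
  constructor
  · intro h0
    obtain ⟨y, hyγ, hys, hyu, ⟨z, hz, hdet⟩, hsg, hfin, ⟨tinf, htinf, hxinf⟩⟩ := hreal p g hg h0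
    obtain ⟨g₀, δ, hg₀, hst, hcl⟩ := exists_unitary_conj_inv_mul_twistGram_eq_of_invariants L hH hHd (γ₀ : unitaryGroup (cmConjRingHom L) H) hyγ hys
      hyu.ne_zero hsg ⟨z, hz, hdet⟩
    -- the self adèle `q = δ ⊗ 1`, conjugator `g₀ ⊗ 1`, ADELIC class `y ⊗ 1`
    set q : MatchingAdeleG₂ L H H γ₀ := MatchingAdeleG₂.ofIsStablyConjSelf hst with hqdef
    have hq : q.adele = (UnitaryGroup.cmDatum L 3 H).toAdelic δ := MatchingAdeleG₂.adele_ofIsStablyConjSelf hst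
    have hg' : toAdeleGL L g₀ * (((UnitaryGroup.cmDatum L 3 H).toAdelic γ₀).val : GL (Fin 3) (AdeleRing (𝓞 L) L)) * (toAdeleGL L g₀)⁻¹ =
        (q.adele.val : GL (Fin 3) (AdeleRing (𝓞 L) L)) := by
      rw [hq, UnitaryGroup.coe_cmDatum_toAdelic, UnitaryGroup.coe_cmDatum_toAdelic, ← map_inv, ← map_mul, ← map_mul, hg₀]
    have hx' : (H.map (algebraMap L (AdeleRing (𝓞 L) L)))⁻¹ * twistGram (adeleConj L) (H.map (algebraMap L (AdeleRing (𝓞 L) L)))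
          ((toAdeleGL L g₀ : GL (Fin 3) (AdeleRing (𝓞 L) L)) : Matrix (Fin 3) (Fin 3) (AdeleRing (𝓞 L) L)) = y.map (algebraMap L (AdeleRing (𝓞 L) L)) := by
      rw [val_toAdeleGL, ← twistGram_map_adele, ← Literature.LinearAlgebra.Matrix.map_nonsing_inv_of_isUnit _ (Ne.isUnit hHd), ← Matrix.map_mul, hcl]
    -- finite places: the local identity for `(g, y)` is the local identity for `(g, g₀ ⊗ 1)`
    have hv : ∀ v : HeightOneSpectrum (𝓞 ↥(maximalRealSubfield L)),
        IsConj ((UnitaryGroup.cmDatum L 3 H).toLocal v q.adele) ((UnitaryGroup.cmDatum L 3 H).toLocal v p.adele) := fun v => by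
      obtain ⟨t, ht, hxt⟩ := hfin v
      rw [← hx'] at hxt
      exact hlocFin p q g (toAdeleGL L g₀) v t hg hg' ht hxt
    -- the archimedean place
    have ha : IsConj q.arch p.arch := by
      rw [← hx'] at hxinf
      exact hlocArch p q g (toAdeleGL L g₀) tinf hg hg' htinf hxinf
    refine ⟨δ, hglue p δ hst ?_ fun v => ?_⟩
    · have ha' : q.arch = cmRationalToArch L 3 H δ := by
        show UnitaryGroup.archPart (↥(maximalRealSubfield L)) L (IsCMField.complexConj L) 3 H q.adele = _
        rw [hq, archPart_cmDatum_toAdelic]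
      rw [← ha']
      exact ha
    · have := hv v
      rwa [hq] at this
  · -- (←): rational ⇒ principal ADELIC representative (★ R6d-β) ⇒ `obs = 0` by `hvan`
    rintro ⟨γ, hp⟩
    obtain ⟨g₀, hg₀, t, ht, hx⟩ := exists_exists_commute_adelicCartan_eq_map_of_isRationalOver (Ne.isUnit hHd) hp hg
    obtain ⟨hyγ, hys, hyu⟩ := globalCartan_props hH hHd hg₀
    exact hvan p g _ t hg hyγ hys hyu ht hx

end Placewise

end Literature.NumberTheory.Rogawski1990

end
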